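import Literature.NumberTheory.LFunctions.SiegelZeroExceptionalPrimes
import Literature.NumberTheory.LFunctions.ZetaMulHarmonicMean
import Literature.NumberTheory.LFunctions.ExceptionalZeroLogDerivOne
import Literature.NumberTheory.LFunctions.SiegelExceptionalZeroBound
import Literature.NumberTheory.LFunctions.SmoothEulerProductSandwich
import HarnessLib

/-!
# The harmonic weight `g(n) = (1∗χ)(n)/n` at a Siegel zero: `∑_{n ≤ N} g(n)` is essentially
# constant on `N ≥ q^{(1+ε)/2}` (Tao–Teräväinen 2022, §3.3, (3.12), (3.15), (3.16))

Topic `Literature/NumberTheory/LFunctions`, sub-namespace `SiegelZero`. Everything here is PROVED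
(theorems only, no definitions). This is the analytic engine of the printed proof of
Proposition 3.5 of Tao–Teräväinen, *The Hardy–Littlewood–Chowla conjecture in the presence of a
Siegel zero* (J. London Math. Soc. 106 (2022), arXiv:2109.06291), packaged in the ratio form
consumed by the discharge of its SECOND bound (3.14)
(`SiegelZeroExceptionalPrimesSecond.lean`: `TaoTeravainen2021_eq314_holds`). (The first bound
(3.13) is discharged in `SiegelZeroExceptionalPrimesProofs.lean` with its own inline version of
the same estimates.)

* `HarmWeight.*` — lemmas on a real arithmetic function `g` with `g(n) = (1∗χ)(n)/n` (`χ`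
  quadratic): multiplicative and `≥ 0` (the tree's `SmoothEulerProduct.zetaMul_re_mul`,
  `zetaMul_re_nonneg`), `g(p) = (1 + χ(p))/p`, so `g(p*) ≥ 1/p*` at an exceptional prime
  (`χ(p*) ≠ -1`; `HarmWeight.one_div_le`) and `g(p^k) ≤ (k+1)/p^k`;
* `one_le_harmSum`, `harmSum_mono`, `harmSum_sub_harmSum` — bookkeeping for
  `G(N) = ∑_{n ≤ N} (1∗χ)(n)/n` (written out as the `Finset` sum of `ZetaMulHarmonicMean.lean`).

Analytic inputs, all from the tree: the Montgomery–Vaughan mean value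
`|G(N) - (L'(1,χ) + (log N + γ)L(1,χ))| ≤ 3W(1 + log N)/(y+1) + 2y/N`
(`ZetaMulHarmonic.abs_sum_zetaMul_re_div_sub_le`) with the Pólya–Vinogradov window bound
`W = √q(1 + log q)` (`CharacterTails.norm_window_le_polyaVinogradov`); Siegel's theorem
`L(1,χ) ≥ C(ε) q^{-ε}` (`Siegel.siegel_theorem_primitive`) and its corollary `1 - β ≥ C(ε)q^{-ε}`
(`Siegel.exists_one_sub_realZero_ge`); and `L(1,χ) = (1-β)L'(1,χ)(1 + O(1/η))`
(`ExceptionalZero.exists_abs_sub_le_div_eta`). Proved here: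

* `exists_eta_le_rpow` — (1.4) "`η ≪_ε q_χ^ε`": for `η ≥ η₀(ε)`, `η ≤ q^ε`; hence
  `exists_le_conductor` — large quality forces a large conductor ("By (1.4), this also means that
  `q_χ` … is also sufficiently large", §2.1); `eta_pos_of_LFunction_eq_zero` — `η > 0`;
* `exists_deriv_LFunction_one_ge` — `L'(1,χ) ≥ (η log q/2) L(1,χ) > 0` for `η ≥ η₀`
  ("`(L'/L)(1,χ) ≍ η log q_χ`");
* `exists_abs_harmSum_sub_le` — (3.12) within `L(1,χ)`: for `η ≥ η₀(ε)` and every integer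
  `N ≥ q^{(1+ε)/2}`, `|G(N) - (L'(1,χ) + (log N + γ)L(1,χ))| ≤ L(1,χ)` (choose
  `y = ⌊N ℓ/4⌋`, `ℓ = min(L(1,χ),1)`; the needed `24W(1 + log N) ≤ Nℓ²` holds at
  `N = q^{(1+ε)/2}` for `q ≥ Q₀(ε)` by Siegel with `ε/8`, and propagates to larger `N` because
  `(1 + log t)/t` decreases, `mul_one_add_log_le`);
* `exists_harmSum_ratio_le` — **the engine of Proposition 3.5**: for `η ≥ η₀(ε)` and integers
  `q^{(1+ε)/2} ≤ M ≤ N`, `G(M) > 0` and `(G(N) - G(M)) η log q ≤ 4 (log N - log M + 2) G(M)`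
  ((3.15): `G(q^{(1+ε)/2}) ≫ L(1,χ) η log q`; (3.16): `G(N) - G(M) = L(1,χ)(log(N/M) + O(1))`).

## What the source prints (§3.3, proof of Proposition 3.5, p. 10 of the arXiv version)

"For any `x ≥ q_χ^{(1+ε)/2}` we have from [mv] that
`∑_{n ≤ x} (1∗χ)(n)/n = (log x + γ) L(1,χ) + L'(1,χ) + O_ε(q_χ^{-ε/10})`. From Siegel's theorem we
have `L(1,χ) ≫_ε q_χ^{-ε/10}`, and hence (3.12)
`∑_{n ≤ x} (1∗χ)(n)/n = L(1,χ)(log x + (L'/L)(1,χ) + O_ε(1))`. From [mv] we also have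
`(L'/L)(1,χ) ≍ η log q_χ`. Thus, (3.12) gives (3.15) `∑_{n ≤ q_χ^{(1+ε)/2}} (1∗χ)(n)/n ≫
L(1,χ) η log q_χ`, while applying (3.12) with `x` replaced by `q_χ^{(1+ε)/2}`, `x q_χ^{(1+ε)/2}`
and subtracting we obtain (3.16) `∑_{q_χ^{(1+ε)/2} < n ≤ x q_χ^{(1+ε)/2}} (1∗χ)(n)/n =
L(1,χ)(log x + O_ε(1))`." Conventions (§2.1): constants may depend on `ε` and be ineffective;
"`η` is sufficiently large depending on the fixed quantities".
[cite: TaoTeravainen2021, §3.3 proof of Proposition 3.5, (3.12), (3.15), (3.16); §2.1; (1.4)]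

## Design notes

* Hypotheses are inlined as in `SiegelZeroExceptionalPrimes.lean`: `χ` primitive with `χ² = 1`
  (= `IsQuadratic`, `MulChar.isQuadratic_iff_sq_eq_one`), the zero as
  `χ.LFunction (1 - 1/(η log q)) = 0`, thresholds `∃ η₀` ("`η` sufficiently large"). At `q = 1`
  the zero hypothesis is `ζ(1) = 0`, refuted by Mathlib (`two_le_of_LFunction_eq_zero` of
  `SiegelZeroExceptionalPrimes.lean`), and `η > 0` automatically (`eta_pos_of_LFunction_eq_zero`).
* The sums are indexed by natural numbers `N` (as in `ZetaMulHarmonicMean.lean`, over `Icc 1 N`);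
  real cut-offs enter through `⌊·⌋` in the consumers. No `def` is introduced: the weight is
  handled through the hypothesis `∀ n, g n = (1∗χ)(n)/n` on an `ArithmeticFunction ℝ`.
-/

noncomputable section

open Finset
open Literature.NumberTheory.LFunctions

namespace Literature.NumberTheory.LFunctions.SiegelZero

variable {q : ℕ} (χ : DirichletCharacter ℂ q)

/-! ### The weight `g(n) = (1∗χ)(n)/n` -/

namespace HarmWeight

/-! Lemmas about a real arithmetic function `g` with `g(n) = (1∗χ)(n)/n` (in the consumers,
`g = ⟨fun n => (χ.zetaMul n).re / n, by simp⟩`; no definition is introduced). -/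

variable {χ} {g : ArithmeticFunction ℝ}

/-- `g ≥ 0` for quadratic `χ`. [folklore] -/
theorem nonneg (hχ : χ ^ 2 = 1) (hg : ∀ n, g n = (χ.zetaMul n).re / n) (n : ℕ) : 0 ≤ g n := by
  rw [hg]
  exact div_nonneg (SmoothEulerProduct.zetaMul_re_nonneg χ hχ n) (Nat.cast_nonneg n)

/-- `g` is multiplicative for quadratic `χ` ("multiplicativity of `1∗χ`"). [folklore] -/
theorem isMultiplicative (hχ : χ ^ 2 = 1) (hg : ∀ n, g n = (χ.zetaMul n).re / n) :
    g.IsMultiplicative := by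
  refine ⟨?_, ?_⟩
  · rw [hg, SmoothEulerProduct.zetaMul_one_re]; simp
  · intro m n hmn
    rw [hg, hg, hg, SmoothEulerProduct.zetaMul_re_mul χ hχ hmn, Nat.cast_mul]
    rcases Nat.eq_zero_or_pos m with rfl | hm
    · simp
    rcases Nat.eq_zero_or_pos n with rfl | hn
    · simp
    field_simp

/-- At a prime, `g(p) = (1 + Re χ(p))/p`. [folklore] -/
theorem apply_prime (hχ : χ ^ 2 = 1) (hg : ∀ n, g n = (χ.zetaMul n).re / n) {p : ℕ}
    (hp : p.Prime) : g p = (1 + (χ p).re) / p := by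
  rw [hg]
  have h := SmoothEulerProduct.zetaMul_prime_pow_re χ hχ hp 1
  rw [pow_one] at h
  rw [h, Finset.sum_range_succ, Finset.sum_range_one, pow_zero, pow_one]

/-- At a prime power, `g(p^k) ≤ (k+1)/p^k`. [folklore] -/
theorem apply_prime_pow_le (hχ : χ ^ 2 = 1) (hg : ∀ n, g n = (χ.zetaMul n).re / n) {p : ℕ}
    (hp : p.Prime) (k : ℕ) : g (p ^ k) ≤ (k + 1) / (p : ℝ) ^ k := by
  rw [hg, Nat.cast_pow]
  exact div_le_div_of_nonneg_right (SmoothEulerProduct.zetaMul_prime_pow_re_le χ hχ hp k)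
    (by positivity)

/-- **Exceptional primes carry weight `≥ 1/p`**: if `χ(p) ≠ -1` (`p` prime, `χ` quadratic) then
`1/p ≤ g(p)` (indeed `(1∗χ)(p) = 1 + χ(p) ∈ {1, 2}`; "`1∗χ(p)` is non-negative and is at least
one when `p` is exceptional"). [cite: TaoTeravainen2021, §3.3 proof of Proposition 3.5] -/
theorem one_div_le (hχ : χ ^ 2 = 1) (hg : ∀ n, g n = (χ.zetaMul n).re / n) {p : ℕ}
    (hp : p.Prime) (hex : χ p ≠ -1) : (1 : ℝ) / p ≤ g p := by
  rw [apply_prime hχ hg hp]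
  refine div_le_div_of_nonneg_right ?_ (Nat.cast_nonneg p)
  rcases SmoothEulerProduct.apply_re_trichotomy χ hχ p with h | h | h
  · rw [h]; norm_num
  · rw [h]; norm_num
  · exfalso
    apply hex
    rw [SmoothEulerProduct.apply_eq_re χ hχ p, h]
    simp

/-- The sums of `g` are the harmonic sums `∑_{n ≤ N} (1∗χ)(n)/n`. [folklore] -/
theorem sum_eq (hg : ∀ n, g n = (χ.zetaMul n).re / n) (s : Finset ℕ) :
    ∑ n ∈ s, g n = ∑ n ∈ s, (χ.zetaMul n).re / n :=
  Finset.sum_congr rfl fun n _ => hg n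

end HarmWeight

/-- `∑_{n ≤ N} (1∗χ)(n)/n ≥ 1` for `N ≥ 1` (the term `n = 1`). [folklore] -/
theorem one_le_harmSum (hχ : χ ^ 2 = 1) {N : ℕ} (hN : 1 ≤ N) :
    1 ≤ ∑ n ∈ Icc 1 N, (χ.zetaMul n).re / n := by
  have h1 : (1 : ℝ) = (χ.zetaMul 1).re / (1 : ℕ) := by
    rw [SmoothEulerProduct.zetaMul_one_re]; simp
  rw [h1]
  exact Finset.single_le_sum (f := fun n : ℕ => (χ.zetaMul n).re / n)
    (fun n _ => div_nonneg (SmoothEulerProduct.zetaMul_re_nonneg χ hχ n) (Nat.cast_nonneg n))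
    (Finset.mem_Icc.mpr ⟨le_rfl, hN⟩)

/-- The harmonic sums are non-decreasing in the length. [folklore] -/
theorem harmSum_mono (hχ : χ ^ 2 = 1) {M N : ℕ} (h : M ≤ N) :
    ∑ n ∈ Icc 1 M, (χ.zetaMul n).re / n ≤ ∑ n ∈ Icc 1 N, (χ.zetaMul n).re / n :=
  Finset.sum_le_sum_of_subset_of_nonneg (Finset.Icc_subset_Icc_right h)
    fun n _ _ => div_nonneg (SmoothEulerProduct.zetaMul_re_nonneg χ hχ n) (Nat.cast_nonneg n)

/-- `∑_{n ≤ N} - ∑_{n ≤ M} = ∑_{M < n ≤ N}`. [folklore] -/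
theorem harmSum_sub_harmSum {M N : ℕ} (hMN : M ≤ N) :
    ∑ n ∈ Icc 1 N, (χ.zetaMul n).re / n - ∑ n ∈ Icc 1 M, (χ.zetaMul n).re / n =
      ∑ n ∈ Ioc M N, (χ.zetaMul n).re / n := by
  have h1 : ∑ n ∈ Icc 1 N, (χ.zetaMul n).re / n = ∑ n ∈ Ioc 0 N, (χ.zetaMul n).re / n := rfl
  have h2 : ∑ n ∈ Icc 1 M, (χ.zetaMul n).re / n = ∑ n ∈ Ioc 0 M, (χ.zetaMul n).re / n := rfl
  rw [h1, h2, ← Finset.sum_Ioc_consecutive _ (Nat.zero_le M) hMN]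
  ring

/-! ### The Siegel regime: `η ≪_ε q^ε` ((1.4)), large conductor -/

/-- The quality of a zero `1 - 1/(η log q)` of `L(s, χ)`, `χ ≠ χ₀`, is positive (there are no
zeros with `Re s ≥ 1`). [folklore] -/
theorem eta_pos_of_LFunction_eq_zero [NeZero q] (hχ : χ ≠ 1) {η : ℝ}
    (hL : χ.LFunction ((1 - 1 / (η * Real.log q) : ℝ) : ℂ) = 0) : 0 < η := by
  by_contra h
  rw [not_lt] at h
  have hlogq : 0 ≤ Real.log q := Real.log_natCast_nonneg q
  have hσ : (1 : ℝ) ≤ 1 - 1 / (η * Real.log q) := by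
    have : 1 / (η * Real.log q) ≤ 0 :=
      div_nonpos_of_nonneg_of_nonpos zero_le_one (mul_nonpos_of_nonpos_of_nonneg h hlogq)
    linarith
  exact DirichletCharacter.LFunction_ne_zero_of_one_le_re χ (Or.inl hχ)
    (by rw [Complex.ofReal_re]; exact hσ) hL

/-- **(1.4): "From Siegel's theorem we have the (ineffective) upper bound `η ≪_ε q_χ^ε`"**, in the
form: for every `ε > 0` there is `η₀` such that every real zero `1 - 1/(η log q)` of `L(s, χ)`
(`χ` quadratic, `χ ≠ χ₀`) with `η ≥ η₀` has `η ≤ q^ε`. From MV Corollary 11.15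
(`Literature.NumberTheory.LFunctions.Siegel.exists_one_sub_realZero_ge`: `1 - β ≥ C(ε/2) q^{-ε/2}`).
[cite: TaoTeravainen2021, (1.4)] -/
theorem exists_eta_le_rpow {ε : ℝ} (hε : 0 < ε) :
    ∃ η₀ : ℝ, ∀ (q : ℕ) [NeZero q] (χ : DirichletCharacter ℂ q), χ ≠ 1 → χ ^ 2 = 1 →
      ∀ η : ℝ, η₀ ≤ η → χ.LFunction ((1 - 1 / (η * Real.log q) : ℝ) : ℂ) = 0 → η ≤ (q : ℝ) ^ ε := by
  obtain ⟨C, hC, hS⟩ := Siegel.exists_one_sub_realZero_ge (ε := ε / 2) (half_pos hε)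
  -- `η ≤ q^{ε/2}/(C log 2)`; and `q^{ε/2} ≥ 1/(C log 2)` once `q ≥ q₁`, which `η ≥ η₀` forces
  have hlog2 : 0 < Real.log 2 := Real.log_pos (by norm_num)
  set A : ℝ := 1 / (C * Real.log 2) with hA
  have hA0 : 0 < A := by positivity
  -- `q₁ = A^{2/ε}` (so that `q ≥ q₁ ⇒ q^{ε/2} ≥ A`), `η₀ = A q₁^{ε/2} + 1`
  set q₁ : ℝ := max 1 (A ^ (2 / ε)) with hq₁
  refine ⟨A * q₁ ^ (ε / 2) + 1, fun q _ χ hχ hq2 η hη hL => ?_⟩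
  have hq2' : 2 ≤ q := two_le_of_LFunction_eq_zero hL
  have hqr : (2 : ℝ) ≤ q := by exact_mod_cast hq2'
  have hq0 : (0 : ℝ) < q := by linarith
  have hlogq : Real.log 2 ≤ Real.log q := Real.log_le_log (by norm_num) hqr
  have hlogq0 : 0 < Real.log q := lt_of_lt_of_le hlog2 hlogq
  have hη0 : 0 < η := by
    have : 0 ≤ A * q₁ ^ (ε / 2) := by positivity
    linarith
  -- Siegel: `C q^{-ε/2} ≤ 1/(η log q)`
  have h1 := hS q χ hq2 hχ (1 - 1 / (η * Real.log q)) hL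
  rw [sub_sub_cancel] at h1
  have hηq : η ≤ A * (q : ℝ) ^ (ε / 2) := by
    -- `η log q ≤ q^{ε/2}/C`, `log q ≥ log 2`
    have h2 : η * Real.log q * (C * (q : ℝ) ^ (-(ε / 2))) ≤ 1 := by
      have := mul_le_mul_of_nonneg_left h1 (by positivity : (0 : ℝ) ≤ η * Real.log q)
      rwa [one_div, mul_inv_cancel₀ (by positivity : η * Real.log q ≠ 0)] at this
    have h3 : (q : ℝ) ^ (-(ε / 2)) = 1 / (q : ℝ) ^ (ε / 2) := by
      rw [Real.rpow_neg hq0.le, one_div]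
    rw [h3] at h2
    have hqε : 0 < (q : ℝ) ^ (ε / 2) := Real.rpow_pos_of_pos hq0 _
    have h4 : η * Real.log q * C ≤ (q : ℝ) ^ (ε / 2) := by
      have := mul_le_mul_of_nonneg_right h2 hqε.le
      rwa [one_mul, mul_assoc, mul_assoc, mul_one_div, div_mul_cancel₀ _ hqε.ne', ← mul_assoc]
        at this
    have h5 : η * (Real.log 2 * C) ≤ (q : ℝ) ^ (ε / 2) := by
      calc η * (Real.log 2 * C) ≤ η * (Real.log q * C) := by gcongr
        _ = η * Real.log q * C := by ring
        _ ≤ _ := h4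
    rw [hA]
    rw [one_div, inv_mul_eq_div, le_div_iff₀ (by positivity)]
    linarith [h5]
  -- hence `q ≥ q₁`: otherwise `η < η₀`
  have hqq₁ : q₁ ≤ q := by
    by_contra hcon
    rw [not_le] at hcon
    have : (q : ℝ) ^ (ε / 2) < q₁ ^ (ε / 2) :=
      Real.rpow_lt_rpow hq0.le hcon (by positivity)
    have : A * (q : ℝ) ^ (ε / 2) < A * q₁ ^ (ε / 2) := mul_lt_mul_of_pos_left this hA0
    linarith
  -- and `q^{ε/2} ≥ A`, so `η ≤ A q^{ε/2} ≤ q^{ε/2} q^{ε/2} = q^ε`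
  have hqA : A ≤ (q : ℝ) ^ (ε / 2) := by
    have h1 : A ^ (2 / ε) ≤ q := (le_max_right _ _).trans hqq₁
    have h2 : (A ^ (2 / ε)) ^ (ε / 2) ≤ (q : ℝ) ^ (ε / 2) :=
      Real.rpow_le_rpow (by positivity) h1 (by positivity)
    rwa [← Real.rpow_mul hA0.le, show 2 / ε * (ε / 2) = 1 by field_simp, Real.rpow_one] at h2
  calc η ≤ A * (q : ℝ) ^ (ε / 2) := hηq
    _ ≤ (q : ℝ) ^ (ε / 2) * (q : ℝ) ^ (ε / 2) :=
        mul_le_mul_of_nonneg_right hqA (Real.rpow_nonneg hq0.le _)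
    _ = (q : ℝ) ^ ε := by rw [← Real.rpow_add hq0]; ring_nf

/-- **Large quality forces a large conductor** ("By (1.4), this also means that `q_χ` … is
also sufficiently large depending on the fixed quantities", §2.1): for every `Q` there is `η₀`
such that a zero `1 - 1/(η log q)` of `L(s, χ)` (`χ` quadratic, `χ ≠ χ₀`) with `η ≥ η₀` forces
`q ≥ Q`. [cite: TaoTeravainen2021, §2.1 and (1.4)] -/
theorem exists_le_conductor (Q : ℝ) :
    ∃ η₀ : ℝ, ∀ (q : ℕ) [NeZero q] (χ : DirichletCharacter ℂ q), χ ≠ 1 → χ ^ 2 = 1 →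
      ∀ η : ℝ, η₀ ≤ η → χ.LFunction ((1 - 1 / (η * Real.log q) : ℝ) : ℂ) = 0 → Q ≤ q := by
  obtain ⟨η₁, h⟩ := exists_eta_le_rpow one_pos
  refine ⟨max η₁ Q, fun q _ χ hχ hq2 η hη hL => ?_⟩
  have h1 := h q χ hχ hq2 η ((le_max_left _ _).trans hη) hL
  rw [Real.rpow_one] at h1
  exact ((le_max_right _ _).trans hη).trans h1

/-! ### `L'(1, χ) ≫ η log q · L(1, χ)` -/

/-- **"`(L'/L)(1, χ) ≍ η log q_χ`"** (the Montgomery–Vaughan input of Proposition 3.5), lower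
half, from the tree's `ExceptionalZero.exists_abs_sub_le_div_eta`
(`L(1, χ) = (1 - β) L'(1, χ)(1 + O(1/η))`): there is `η₀` such that for every quadratic `χ ≠ χ₀`
mod `q ≥ 2` and every zero `1 - 1/(η log q)` with `η ≥ η₀`:
`(η log q/2) L(1, χ) ≤ L'(1, χ)` and `L(1, χ) > 0`. [cite: TaoTeravainen2021, §3.3 proof of Proposition 3.5 ("From [mv] we also have `L'/L(1,χ) ≍ η log q_χ`")] -/
theorem exists_deriv_LFunction_one_ge :
    ∃ η₀ : ℝ, ∀ (q : ℕ) [NeZero q] (χ : DirichletCharacter ℂ q), χ ≠ 1 → χ ^ 2 = 1 →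
      ∀ η : ℝ, η₀ ≤ η → χ.LFunction ((1 - 1 / (η * Real.log q) : ℝ) : ℂ) = 0 →
        η * Real.log q / 2 * (χ.LFunction 1).re ≤ (deriv χ.LFunction 1).re ∧
          0 < (χ.LFunction 1).re := by
  obtain ⟨C, η₁, hC, hη₁, H⟩ := ExceptionalZero.exists_abs_sub_le_div_eta
  refine ⟨max η₁ (2 * C), fun q _ χ hχ hq2 η hη hL => ?_⟩
  have hq : 2 ≤ q := two_le_of_LFunction_eq_zero hL
  have hηη₁ : η₁ ≤ η := (le_max_left _ _).trans hη
  have hη2C : 2 * C ≤ η := (le_max_right _ _).trans hη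
  have hη0 : 0 < η := lt_of_lt_of_le hη₁ hηη₁
  have hqr : (2 : ℝ) ≤ q := by exact_mod_cast hq
  have hlogq : 0 < Real.log q := Real.log_pos (by linarith)
  have hLpos : 0 < (χ.LFunction 1).re := Siegel.LFunction_one_re_pos χ hχ hq2
  have h := H q χ hχ hq2 hq η hηη₁ hL
  refine ⟨?_, hLpos⟩
  set L₁ := (χ.LFunction 1).re
  set L₁' := (deriv χ.LFunction 1).re
  -- `(1/(η log q)) L' ≥ L - (C/η) L ≥ L/2`
  have h1 : L₁ - C / η * L₁ ≤ 1 / (η * Real.log q) * L₁' := by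
    have := (abs_sub_le_iff.mp h).2
    linarith
  have h2 : C / η * L₁ ≤ L₁ / 2 := by
    have hCη : C / η ≤ 1 / 2 := by
      rw [div_le_iff₀ hη0]; linarith
    calc C / η * L₁ ≤ 1 / 2 * L₁ := mul_le_mul_of_nonneg_right hCη hLpos.le
      _ = L₁ / 2 := by ring
  have h3 : L₁ / 2 ≤ 1 / (η * Real.log q) * L₁' := by linarith
  have hηlq : 0 < η * Real.log q := by positivity
  have h4 := mul_le_mul_of_nonneg_left h3 hηlq.le
  rw [← mul_assoc, mul_one_div, div_self hηlq.ne', one_mul] at h4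
  calc η * Real.log q / 2 * L₁ = η * Real.log q * (L₁ / 2) := by ring
    _ ≤ L₁' := h4


/-! ### The Montgomery–Vaughan asymptotic within `L(1, χ)` -/

/-- `M (1 + log N) ≤ N (1 + log M)` for `1 ≤ M ≤ N` (i.e. `(1 + log t)/t` is non-increasing on
`[1, ∞)`; from `log(N/M) ≤ N/M - 1`). [folklore] -/
theorem mul_one_add_log_le {M N : ℝ} (hM : 1 ≤ M) (hMN : M ≤ N) :
    M * (1 + Real.log N) ≤ N * (1 + Real.log M) := by
  have hM0 : 0 < M := by linarith
  have hN0 : 0 < N := by linarith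
  have hlogM : 0 ≤ Real.log M := Real.log_nonneg hM
  have h1 : Real.log N - Real.log M ≤ N / M - 1 := by
    rw [← Real.log_div hN0.ne' hM0.ne']
    exact Real.log_le_sub_one_of_pos (by positivity)
  have h2 : M * (Real.log N - Real.log M) ≤ N - M := by
    have := mul_le_mul_of_nonneg_left h1 hM0.le
    have e : M * (N / M - 1) = N - M := by field_simp
    linarith
  nlinarith

/-- **The asymptotic (3.12) within `L(1, χ)`, explicit form.** If the window sums of the quadratic
`χ ≠ χ₀` are bounded by `W ≥ 1` and `24 W (1 + log N) ≤ N ℓ²` with `ℓ = min(L(1,χ), 1)`, then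
`|G(N) - (L'(1, χ) + (log N + γ) L(1, χ))| ≤ L(1, χ)` (the tree's
`ZetaMulHarmonic.abs_sum_zetaMul_re_div_sub_le` with `y = ⌊Nℓ/4⌋`).
[cite: TaoTeravainen2021, §3.3 (3.12)] -/
theorem abs_harmSum_sub_le_of_key [NeZero q] (hχ : χ ≠ 1) (hq : χ ^ 2 = 1) {W : ℝ} (hW1 : 1 ≤ W)
    (hW : ∀ N n : ℕ, ‖∑ k ∈ Ioc N n, χ (k : ZMod q)‖ ≤ W) {N : ℕ}
    (hLpos : 0 < (χ.LFunction 1).re)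
    (hkey : 24 * W * (1 + Real.log N) ≤ N * (min (χ.LFunction 1).re 1) ^ 2) :
    |∑ n ∈ Icc 1 N, (χ.zetaMul n).re / n - ((deriv χ.LFunction 1).re +
        (Real.log N + Real.eulerMascheroniConstant) * (χ.LFunction 1).re)| ≤
      (χ.LFunction 1).re := by
  set L₁ : ℝ := (χ.LFunction 1).re with hL₁
  set ℓ : ℝ := min L₁ 1 with hℓ
  have hℓ0 : 0 < ℓ := lt_min hLpos one_pos
  have hℓ1 : ℓ ≤ 1 := min_le_right _ _
  have hℓL : ℓ ≤ L₁ := min_le_left _ _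
  have hlogN : 0 ≤ Real.log N := Real.log_natCast_nonneg N
  have hN0 : (0 : ℝ) < N := by
    by_contra h
    rw [not_lt] at h
    have : (N : ℝ) * ℓ ^ 2 ≤ 0 := mul_nonpos_of_nonpos_of_nonneg h (sq_nonneg _)
    have : (24 : ℝ) ≤ 24 * W * (1 + Real.log N) := by nlinarith
    linarith
  -- `N ℓ ≥ N ℓ² ≥ 24`
  have hNℓ2 : 24 ≤ (N : ℝ) * ℓ ^ 2 := by nlinarith
  have hNℓ : 24 ≤ (N : ℝ) * ℓ := by nlinarith
  -- `y = ⌊N ℓ / 4⌋`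
  set y : ℕ := ⌊(N : ℝ) * ℓ / 4⌋₊ with hy
  have hy4 : (N : ℝ) * ℓ / 4 - 1 < y := by
    have := Nat.lt_floor_add_one ((N : ℝ) * ℓ / 4); linarith
  have hyle : (y : ℝ) ≤ (N : ℝ) * ℓ / 4 := Nat.floor_le (by positivity)
  have hy2 : 2 ≤ y := by
    have : (2 : ℝ) ≤ y := by linarith
    exact_mod_cast this
  have hyN : y ≤ N := by
    have : (y : ℝ) ≤ N := by nlinarith
    exact_mod_cast this
  have h := ZetaMulHarmonic.abs_sum_zetaMul_re_div_sub_le χ hχ hq hW hy2 hyN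
  refine h.trans ?_
  -- `3W(1 + log N)/(y+1) ≤ ℓ/2` and `2y/N ≤ ℓ/2`
  have hy1 : (N : ℝ) * ℓ / 4 ≤ (y : ℝ) + 1 := by linarith
  have t1 : 3 * W * (1 + Real.log N) / ((y : ℝ) + 1) ≤ ℓ / 2 := by
    rw [div_le_iff₀ (by positivity)]
    have : 3 * W * (1 + Real.log N) ≤ ℓ / 2 * ((N : ℝ) * ℓ / 4) := by nlinarith
    exact this.trans (mul_le_mul_of_nonneg_left hy1 (by positivity))
  have t2 : 2 * (y : ℝ) / N ≤ ℓ / 2 := by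
    rw [div_le_iff₀ hN0]; linarith
  linarith

/-- **The asymptotic (3.12) within `L(1, χ)` at a Siegel zero.** For every `ε > 0` there is `η₀`
such that for every primitive quadratic `χ` mod `q`, every zero `1 - 1/(η log q)` of `L(s, χ)`
with `η ≥ η₀`, and every integer `N ≥ q^{(1+ε)/2}`:
`|G(N) - (L'(1, χ) + (log N + γ) L(1, χ))| ≤ L(1, χ)` — Montgomery–Vaughan's
"`∑_{n ≤ x} (1∗χ)(n)/n = (log x + γ)L(1,χ) + L'(1,χ) + O_ε(q^{-ε/10})`" with the error compared
to `L(1, χ) ≫_ε q^{-ε/10}` ("From Siegel's theorem we have `L(1,χ) ≫_ε q_χ^{-ε/10}`, and hence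
(3.12)"); inputs: Pólya–Vinogradov (tree), the hyperbola-method mean value
(`ZetaMulHarmonicMean.lean`), Siegel's theorem (`SiegelTheorem.lean`) and `exists_le_conductor`.
[cite: TaoTeravainen2021, §3.3 (3.12)] -/
theorem exists_abs_harmSum_sub_le {ε : ℝ} (hε : 0 < ε) :
    ∃ η₀ : ℝ, ∀ (q : ℕ) [NeZero q] (χ : DirichletCharacter ℂ q), χ.IsPrimitive → χ ^ 2 = 1 →
      ∀ η : ℝ, η₀ ≤ η → χ.LFunction ((1 - 1 / (η * Real.log q) : ℝ) : ℂ) = 0 →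
        ∀ N : ℕ, (q : ℝ) ^ ((1 + ε) / 2) ≤ N →
          |∑ n ∈ Icc 1 N, (χ.zetaMul n).re / n - ((deriv χ.LFunction 1).re +
              (Real.log N + Real.eulerMascheroniConstant) * (χ.LFunction 1).re)| ≤
            (χ.LFunction 1).re := by
  obtain ⟨C₁, hC₁, hSiegel⟩ := Siegel.siegel_theorem_primitive (ε := ε / 8) (by positivity)
  -- constants
  set C : ℝ := min C₁ 1 with hC
  have hC0 : 0 < C := lt_min hC₁ one_pos
  have hCle : C ≤ 1 := min_le_right _ _
  have hCC₁ : C ≤ C₁ := min_le_left _ _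
  set B : ℝ := 1 + 16 / ε with hB
  have hB1 : 1 ≤ B := by have : 0 ≤ 16 / ε := by positivity
                         linarith
  set A : ℝ := 24 * (B * ((1 + ε) * B)) / C ^ 2 with hA
  have hA0 : 0 < A := by positivity
  set Q₀ : ℝ := A ^ (8 / ε) with hQ₀
  obtain ⟨η₀, hcond⟩ := exists_le_conductor Q₀
  refine ⟨η₀, fun q _ χ hprim hq2 η hη hL N hN => ?_⟩
  have hq : 2 ≤ q := two_le_of_LFunction_eq_zero hL
  have hχ : χ ≠ 1 := CharacterTails.ne_one_of_isPrimitive χ hprim hq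
  have hqr : (2 : ℝ) ≤ q := by exact_mod_cast hq
  have hq0 : (0 : ℝ) < q := by linarith
  have hq1 : (1 : ℝ) ≤ q := by linarith
  have hQq : Q₀ ≤ q := hcond q χ hχ hq2 η hη hL
  have hLpos : 0 < (χ.LFunction 1).re := Siegel.LFunction_one_re_pos χ hχ hq2
  -- the window bound `W = √q (1 + log q)`
  set W : ℝ := Real.sqrt q * (1 + Real.log q) with hWdef
  have hlogq : 0 ≤ Real.log q := Real.log_nonneg hq1
  have hsqrt1 : 1 ≤ Real.sqrt q := by
    rw [show (1 : ℝ) = Real.sqrt 1 from Real.sqrt_one.symm]; exact Real.sqrt_le_sqrt hq1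
  have hW1 : 1 ≤ W := by rw [hWdef]; nlinarith
  have hW : ∀ N n : ℕ, ‖∑ k ∈ Ioc N n, χ (k : ZMod q)‖ ≤ W := fun N n =>
    CharacterTails.norm_window_le_polyaVinogradov χ hprim hq N n
  refine abs_harmSum_sub_le_of_key χ hχ hq2 hW1 hW hLpos ?_
  -- the key inequality, first at the real point `M = q^{(1+ε)/2}`, then at `N ≥ M`
  set M : ℝ := (q : ℝ) ^ ((1 + ε) / 2) with hM
  have hM1 : 1 ≤ M := Real.one_le_rpow hq1 (by positivity)
  have hM0 : 0 < M := by linarith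
  set ℓ : ℝ := min (χ.LFunction 1).re 1 with hℓ
  -- `ℓ ≥ C q^{-ε/8}`
  have hℓC : C * (q : ℝ) ^ (-(ε / 8)) ≤ ℓ := by
    have h1 : C₁ * (q : ℝ) ^ (-(ε / 8)) ≤ (χ.LFunction 1).re := hSiegel q χ hq2 hprim hχ
    have hqe : (q : ℝ) ^ (-(ε / 8)) ≤ 1 := Real.rpow_le_one_of_one_le_of_nonpos hq1 (by linarith)
    have hqe0 : 0 ≤ (q : ℝ) ^ (-(ε / 8)) := Real.rpow_nonneg hq0.le _
    refine le_min ?_ ?_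
    · exact (mul_le_mul_of_nonneg_right hCC₁ hqe0).trans h1
    · calc C * (q : ℝ) ^ (-(ε / 8)) ≤ 1 * 1 := mul_le_mul hCle hqe hqe0 zero_le_one
        _ = 1 := one_mul _
  -- logarithms against `q^{ε/16}`
  have hqe16 : 1 ≤ (q : ℝ) ^ (ε / 16) := Real.one_le_rpow hq1 (by positivity)
  have hlog1 : 1 + Real.log q ≤ B * (q : ℝ) ^ (ε / 16) := by
    have h1 : Real.log q ≤ (q : ℝ) ^ (ε / 16) / (ε / 16) := Real.log_le_rpow_div hq0.le (by positivity)
    rw [hB, add_mul, one_mul]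
    have h2 : (q : ℝ) ^ (ε / 16) / (ε / 16) = 16 / ε * (q : ℝ) ^ (ε / 16) := by
      field_simp
    linarith [h1, h2]
  have hlogM : 1 + Real.log M ≤ (1 + ε) * B * (q : ℝ) ^ (ε / 16) := by
    rw [hM, Real.log_rpow hq0]
    have h1 : (1 + ε) / 2 * Real.log q ≤ (1 + ε) * Real.log q := by nlinarith
    calc 1 + (1 + ε) / 2 * Real.log q ≤ (1 + ε) * (1 + Real.log q) := by nlinarith
      _ ≤ (1 + ε) * (B * (q : ℝ) ^ (ε / 16)) := mul_le_mul_of_nonneg_left hlog1 (by linarith)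
      _ = (1 + ε) * B * (q : ℝ) ^ (ε / 16) := by ring
  -- `24 W (1 + log M) ≤ 24 B ((1+ε)B) q^{1/2 + ε/8}`
  have hsqrt : Real.sqrt q = (q : ℝ) ^ ((1 : ℝ) / 2) := Real.sqrt_eq_rpow _
  have hlhs : 24 * W * (1 + Real.log M) ≤
      24 * (B * ((1 + ε) * B)) * ((q : ℝ) ^ ((1 : ℝ) / 2) * (q : ℝ) ^ (ε / 8)) := by
    have h1 : W ≤ Real.sqrt q * (B * (q : ℝ) ^ (ε / 16)) :=
      mul_le_mul_of_nonneg_left hlog1 (by positivity)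
    have h2 : W * (1 + Real.log M) ≤
        (Real.sqrt q * (B * (q : ℝ) ^ (ε / 16))) * ((1 + ε) * B * (q : ℝ) ^ (ε / 16)) :=
      mul_le_mul h1 hlogM (by have := Real.log_nonneg hM1; linarith) (by positivity)
    have h3 : (q : ℝ) ^ (ε / 16) * (q : ℝ) ^ (ε / 16) = (q : ℝ) ^ (ε / 8) := by
      rw [← Real.rpow_add hq0]; ring_nf
    calc 24 * W * (1 + Real.log M) = 24 * (W * (1 + Real.log M)) := by ring
      _ ≤ 24 * ((Real.sqrt q * (B * (q : ℝ) ^ (ε / 16))) * ((1 + ε) * B * (q : ℝ) ^ (ε / 16))) :=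
          mul_le_mul_of_nonneg_left h2 (by norm_num)
      _ = 24 * (B * ((1 + ε) * B)) * ((q : ℝ) ^ ((1 : ℝ) / 2) *
            ((q : ℝ) ^ (ε / 16) * (q : ℝ) ^ (ε / 16))) := by rw [hsqrt]; ring
      _ = _ := by rw [h3]
  -- `M ℓ² ≥ C² q^{1/2 + ε/4}`
  have hrhs : C ^ 2 * ((q : ℝ) ^ ((1 : ℝ) / 2) * (q : ℝ) ^ (ε / 4)) ≤ M * ℓ ^ 2 := by
    have h1 : (C * (q : ℝ) ^ (-(ε / 8))) ^ 2 ≤ ℓ ^ 2 :=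
      pow_le_pow_left₀ (by positivity) hℓC 2
    have h2 : (C * (q : ℝ) ^ (-(ε / 8))) ^ 2 = C ^ 2 * (q : ℝ) ^ (-(ε / 4)) := by
      rw [mul_pow, ← Real.rpow_natCast ((q : ℝ) ^ (-(ε / 8))) 2, ← Real.rpow_mul hq0.le]
      norm_num; left; ring_nf
    have h3 : M * (C ^ 2 * (q : ℝ) ^ (-(ε / 4))) = C ^ 2 * ((q : ℝ) ^ ((1 : ℝ) / 2) * (q : ℝ) ^ (ε / 4)) := by
      rw [hM, show C ^ 2 * ((q : ℝ) ^ ((1 : ℝ) / 2) * (q : ℝ) ^ (ε / 4)) =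
        C ^ 2 * ((q : ℝ) ^ ((1 + ε) / 2) * (q : ℝ) ^ (-(ε / 4))) by
          rw [← Real.rpow_add hq0, ← Real.rpow_add hq0]; ring_nf]
      ring
    rw [← h3]
    rw [h2] at h1
    exact mul_le_mul_of_nonneg_left h1 hM0.le
  -- `q ≥ Q₀` gives `24 B((1+ε)B)/C² ≤ q^{ε/8}`
  have hmid : 24 * (B * ((1 + ε) * B)) * (q : ℝ) ^ (ε / 8) ≤ C ^ 2 * (q : ℝ) ^ (ε / 4) := by
    have h1 : A ≤ (q : ℝ) ^ (ε / 8) := by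
      have h2 : Q₀ ^ (ε / 8) ≤ (q : ℝ) ^ (ε / 8) := Real.rpow_le_rpow (by positivity) hQq (by positivity)
      rwa [hQ₀, ← Real.rpow_mul hA0.le, show 8 / ε * (ε / 8) = 1 by field_simp, Real.rpow_one] at h2
    have h3 : (q : ℝ) ^ (ε / 4) = (q : ℝ) ^ (ε / 8) * (q : ℝ) ^ (ε / 8) := by
      rw [← Real.rpow_add hq0]; ring_nf
    rw [h3]
    have h4 : 24 * (B * ((1 + ε) * B)) = A * C ^ 2 := by rw [hA]; field_simp
    rw [h4]
    calc A * C ^ 2 * (q : ℝ) ^ (ε / 8) = C ^ 2 * (A * (q : ℝ) ^ (ε / 8)) := by ring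
      _ ≤ C ^ 2 * ((q : ℝ) ^ (ε / 8) * (q : ℝ) ^ (ε / 8)) := by
          refine mul_le_mul_of_nonneg_left ?_ (sq_nonneg _)
          exact mul_le_mul_of_nonneg_right h1 (Real.rpow_nonneg hq0.le _)
  have hkeyM : 24 * W * (1 + Real.log M) ≤ M * ℓ ^ 2 := by
    calc 24 * W * (1 + Real.log M)
        ≤ 24 * (B * ((1 + ε) * B)) * ((q : ℝ) ^ ((1 : ℝ) / 2) * (q : ℝ) ^ (ε / 8)) := hlhs
      _ = (q : ℝ) ^ ((1 : ℝ) / 2) * (24 * (B * ((1 + ε) * B)) * (q : ℝ) ^ (ε / 8)) := by ring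
      _ ≤ (q : ℝ) ^ ((1 : ℝ) / 2) * (C ^ 2 * (q : ℝ) ^ (ε / 4)) :=
          mul_le_mul_of_nonneg_left hmid (Real.rpow_nonneg hq0.le _)
      _ = C ^ 2 * ((q : ℝ) ^ ((1 : ℝ) / 2) * (q : ℝ) ^ (ε / 4)) := by ring
      _ ≤ M * ℓ ^ 2 := hrhs
  -- transfer from `M` to `N ≥ M`
  have hMN : M ≤ N := hN
  have hmono := mul_one_add_log_le hM1 hMN
  have hW0 : 0 ≤ 24 * W := by positivity
  -- `24 W (1 + log N) ≤ 24 W · N (1 + log M)/M ≤ N ℓ²`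
  have hN0 : (0 : ℝ) < N := by linarith
  have h1 : 24 * W * (1 + Real.log N) * M ≤ (N : ℝ) * ℓ ^ 2 * M := by
    calc 24 * W * (1 + Real.log N) * M = 24 * W * (M * (1 + Real.log N)) := by ring
      _ ≤ 24 * W * (N * (1 + Real.log M)) := mul_le_mul_of_nonneg_left hmono hW0
      _ = N * (24 * W * (1 + Real.log M)) := by ring
      _ ≤ N * (M * ℓ ^ 2) := mul_le_mul_of_nonneg_left hkeyM hN0.le
      _ = (N : ℝ) * ℓ ^ 2 * M := by ring
  exact le_of_mul_le_mul_right h1 hM0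

/-! ### `G` is essentially constant on `[q^{(1+ε)/2}, ∞)` in the ratio sense -/

/-- **The engine of Proposition 3.5** ((3.12), (3.15), (3.16) combined): for every `ε > 0` there
is `η₀` such that for every primitive quadratic `χ` mod `q`, every zero `1 - 1/(η log q)` with
`η ≥ η₀`, and all integers `q^{(1+ε)/2} ≤ M ≤ N`: `G(M) > 0` and
`(G(N) - G(M)) · η log q ≤ 4 (log N - log M + 2) G(M)` — i.e.
"`∑_{n ≤ q^{(1+ε)/2}} (1∗χ)(n)/n ≫ L(1,χ) η log q_χ`" ((3.15)) against
"`∑_{M < n ≤ N} (1∗χ)(n)/n = L(1,χ)(log(N/M) + O_ε(1))`" ((3.16)).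
[cite: TaoTeravainen2021, §3.3 (3.12), (3.15), (3.16)] -/
theorem exists_harmSum_ratio_le {ε : ℝ} (hε : 0 < ε) :
    ∃ η₀ : ℝ, ∀ (q : ℕ) [NeZero q] (χ : DirichletCharacter ℂ q), χ.IsPrimitive → χ ^ 2 = 1 →
      ∀ η : ℝ, η₀ ≤ η → χ.LFunction ((1 - 1 / (η * Real.log q) : ℝ) : ℂ) = 0 →
        ∀ M N : ℕ, (q : ℝ) ^ ((1 + ε) / 2) ≤ M → M ≤ N →
          0 < ∑ n ∈ Icc 1 M, (χ.zetaMul n).re / n ∧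
            (∑ n ∈ Icc 1 N, (χ.zetaMul n).re / n - ∑ n ∈ Icc 1 M, (χ.zetaMul n).re / n) *
                (η * Real.log q) ≤
              4 * (Real.log N - Real.log M + 2) * ∑ n ∈ Icc 1 M, (χ.zetaMul n).re / n := by
  obtain ⟨η₁, h₁⟩ := exists_abs_harmSum_sub_le (ε := ε) hε
  obtain ⟨η₂, h₂⟩ := exists_deriv_LFunction_one_ge
  refine ⟨max (max η₁ η₂) 8, fun q _ χ hprim hq2 η hη hL M N hM hMN => ?_⟩
  have hη₁ : η₁ ≤ η := ((le_max_left _ _).trans (le_max_left _ _)).trans hη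
  have hη₂ : η₂ ≤ η := ((le_max_right _ _).trans (le_max_left _ _)).trans hη
  have hη8 : 8 ≤ η := (le_max_right _ _).trans hη
  have hq : 2 ≤ q := two_le_of_LFunction_eq_zero hL
  have hχ : χ ≠ 1 := CharacterTails.ne_one_of_isPrimitive χ hprim hq
  have hqr : (2 : ℝ) ≤ q := by exact_mod_cast hq
  have hq0 : (0 : ℝ) < q := by linarith
  have hq1 : (1 : ℝ) ≤ q := by linarith
  -- `η log q ≥ 4`
  have hlog2 : (1 : ℝ) / 2 < Real.log 2 := by have := Real.log_two_gt_d9; linarith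
  have hlogq : Real.log 2 ≤ Real.log q := Real.log_le_log (by norm_num) hqr
  have hηlq : 4 ≤ η * Real.log q := by nlinarith
  obtain ⟨hderiv, hLpos⟩ := h₂ q χ hχ hq2 η hη₂ hL
  set L₁ : ℝ := (χ.LFunction 1).re with hL₁
  set L₁' : ℝ := (deriv χ.LFunction 1).re with hL₁'
  set γ : ℝ := Real.eulerMascheroniConstant
  have hγ0 : 0 < γ := lt_trans (by norm_num) Real.one_half_lt_eulerMascheroniConstant
  have hM1 : (1 : ℝ) ≤ M := (Real.one_le_rpow hq1 (by positivity)).trans hM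
  have hlogM : 0 ≤ Real.log M := Real.log_nonneg hM1
  have hN : (q : ℝ) ^ ((1 + ε) / 2) ≤ N := hM.trans (by exact_mod_cast hMN)
  have hlogMN : Real.log M ≤ Real.log N :=
    Real.log_le_log (by linarith) (by exact_mod_cast hMN)
  set GM : ℝ := ∑ n ∈ Icc 1 M, (χ.zetaMul n).re / n with hGMdef
  set GN : ℝ := ∑ n ∈ Icc 1 N, (χ.zetaMul n).re / n with hGNdef
  have eM := abs_sub_le_iff.mp (h₁ q χ hprim hq2 η hη₁ hL M hM)
  have eN := abs_sub_le_iff.mp (h₁ q χ hprim hq2 η hη₁ hL N hN)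
  -- `G(M) ≥ L' + (log M + γ) L - L ≥ (η log q/2) L - L ≥ (η log q/4) L > 0`
  have hGM : η * Real.log q / 4 * L₁ ≤ GM := by
    have h1 : L₁' + (Real.log M + γ) * L₁ - L₁ ≤ GM := by linarith [eM.2]
    have h2 : 0 ≤ (Real.log M + γ) * L₁ := by positivity
    nlinarith
  have hGMpos : 0 < GM := lt_of_lt_of_le (by positivity) hGM
  refine ⟨hGMpos, ?_⟩
  -- `G(N) - G(M) ≤ (log N - log M + 2) L`
  have hdiff : GN - GM ≤ (Real.log N - Real.log M + 2) * L₁ := by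
    nlinarith [eN.1, eM.2]
  have hc0 : 0 ≤ Real.log N - Real.log M + 2 := by linarith
  calc (GN - GM) * (η * Real.log q)
      ≤ (Real.log N - Real.log M + 2) * L₁ * (η * Real.log q) :=
        mul_le_mul_of_nonneg_right hdiff (by positivity)
    _ = (Real.log N - Real.log M + 2) * (4 * (η * Real.log q / 4 * L₁)) := by ring
    _ ≤ (Real.log N - Real.log M + 2) * (4 * GM) :=
        mul_le_mul_of_nonneg_left (mul_le_mul_of_nonneg_left hGM (by norm_num)) hc0
    _ = 4 * (Real.log N - Real.log M + 2) * GM := by ring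

end Literature.NumberTheory.LFunctions.SiegelZero
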